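import Summits.HubbardSuperconductivity.HubbardSuperconductivity.Theorems.AnisotropyChordTransferFibre3C0Layer

/-!
# Route `AnisotropyChord` / H0 rotor rung: ★ THE N₁ IDENTITY `N1Identity` (PartN33 Layer A) PROVED

Memo 21 §297(B) (theory seat `hubbard-h0-rotor-theory-1`): for the `K₁` trial state `Ψ¹ = vΠ⁰` of a two-magnon profile,
`N₁ := Re⟨Ψ¹,(H − ε₁ − T⁺)Ψ¹⟩ = −(ε₁ + T⁺ − 3λ₂)·B − (ε₁/2)·G₂ + B_C`, where `B = 2⟨κΠ⁰,Π⁰⟩`, `G₂ = Σ(Π⁰∘hop − Π⁰)²`,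
`B_C = 2⟨κΠ⁰,C0⟩`, `κ = (|v|² − 3)/2`.  Ingredients: `discreteIMS_holds` (`…Fibre3IMS`), `|Ψ¹|² = (3 + 2κ)Π⁰²`,
`Σ_c Π⁰(c)Π⁰(c+s) = ‖Π⁰‖² − ½‖Π⁰∘s − Π⁰‖²` (translation invariance), `(H⁰−ΔW)Π⁰ = C0 + 3λ₂Π⁰` off `D`, `Π⁰ = 0` on `D`,
and `⟨Π⁰,C0⟩ = (T⁺ − 3λ₂)‖Π⁰‖²` (`sum_piR_C0fn`, `…Fibre3C0Layer`).  **`n1Identity_holds (Δ) : N1Identity L Δ`.**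
Prover seat `hubbard-h0-rotor-p1` g22; helper for stmt-HubbardSuperconductivity-19089 (`--supports`).
-/

set_option linter.dupNamespace false
set_option autoImplicit false

noncomputable section

open scoped BigOperators
open Complex

namespace Summit.HubbardSuperconductivity.HubbardSuperconductivity.Theorems.AnisotropyChord.Transfer.Fibre3

variable (L : ℕ) [NeZero L]

/-! ## Pointwise facts -/

omit [NeZero L] in
/-- `|v|² = 3 + 2κ`. [folklore] -/
theorem normSq_vfun_eq (c : Cfg L) : Complex.normSq (vfun L c) = 3 + 2 * kapV L c := by
  unfold kapV; ring

omit [NeZero L] in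
/-- `|Ψ¹(c)|² = (3 + 2κ(c)) Π⁰(c)²`. [folklore] -/
theorem normSq_trialK1 (f : Tor L → ℝ) (c : Cfg L) :
    Complex.normSq (trialK1 L f c) = (3 + 2 * kapV L c) * piR L f c ^ 2 := by
  unfold trialK1
  rw [Complex.normSq_mul, prodState_eq_piR, Complex.normSq_ofReal, normSq_vfun_eq]
  ring

/-- `‖Ψ¹‖² = 3‖Π⁰‖² + B`. [folklore] -/
theorem ip_trialK1_self_re (f : Tor L → ℝ) :
    (ip L (trialK1 L f) (trialK1 L f)).re = 3 * PiNormSq L f + Bterm L f := by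
  rw [ip_self_re]
  unfold PiNormSq Bterm
  rw [Finset.mul_sum, Finset.mul_sum, ← Finset.sum_add_distrib]
  refine Finset.sum_congr rfl fun c _ => ?_
  rw [← Complex.normSq_eq_norm_sq, normSq_trialK1]
  ring

/-- `Σ_c W|Ψ¹|² = Σ_c W(3 + 2κ)Π⁰²`. [folklore] -/
theorem sum_W_trialK1 (f : Tor L → ℝ) :
    ∑ c : Cfg L, (Wcount L c : ℝ) * ‖trialK1 L f c‖ ^ 2
      = ∑ c : Cfg L, (Wcount L c : ℝ) * ((3 + 2 * kapV L c) * piR L f c ^ 2) := by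
  refine Finset.sum_congr rfl fun c _ => ?_
  rw [← Complex.normSq_eq_norm_sq, normSq_trialK1]

omit [NeZero L] in
/-- `(H₀⁰Π⁰)(c).re = (HΠ⁰)(c).re + ΔW Π⁰(c)`. [folklore] -/
theorem H0apply_zero_prodState_re (Δ : ℝ) (f : Tor L → ℝ) (c : Cfg L) :
    (H0apply L 0 (prodState L f) c).re = (Happly L 0 Δ (prodState L f) c).re + Δ * (Wcount L c : ℝ) * piR L f c := by
  have h : H0apply L 0 (prodState L f) c
      = Happly L 0 Δ (prodState L f) c + (((Δ * (Wcount L c : ℝ) * piR L f c) : ℝ) : ℂ) := by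
    unfold Happly; rw [prodState_eq_piR]; push_cast; ring
  rw [h, Complex.add_re, Complex.ofReal_re]

/-- pointwise: `Π⁰·(H₀⁰Π⁰).re = Π⁰·(C0 + 3λ₂Π⁰ + ΔWΠ⁰)` (on `D` both sides vanish). [folklore] -/
theorem piR_mul_H0apply_re {Δ lam2 : ℝ} {f : Tor L → ℝ} (hf : IsTwoMagnon L Δ lam2 f) (c : Cfg L) :
    piR L f c * (H0apply L 0 (prodState L f) c).re
      = piR L f c * (C0fn L Δ lam2 f c + 3 * lam2 * piR L f c + Δ * (Wcount L c : ℝ) * piR L f c) := by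
  rw [H0apply_zero_prodState_re L Δ]
  unfold C0fn
  split_ifs with hc
  · rw [piR_D L hf.1 c hc]; ring
  · ring

/-- `Re⟨|v|²Π⁰, H₀⁰Π⁰⟩ = Σ (3+2κ)Π⁰·(H₀⁰Π⁰).re`. [folklore] -/
theorem re_ip_vsqPi_H0 (f : Tor L → ℝ) :
    (ip L (fun c => ((Complex.normSq (vfun L c) : ℝ) : ℂ) * prodState L f c) (H0apply L 0 (prodState L f))).re
      = ∑ c : Cfg L, (3 + 2 * kapV L c) * piR L f c * (H0apply L 0 (prodState L f) c).re := by
  unfold ip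
  rw [Complex.re_sum]
  refine Finset.sum_congr rfl fun c _ => ?_
  simp only [prodState_eq_piR]
  rw [← Complex.ofReal_mul, Complex.conj_ofReal, Complex.re_ofReal_mul, normSq_vfun_eq]

/-! ## The hop sums: `Σ Π⁰(c)Π⁰(c+s) = ‖Π⁰‖² − ½‖Π⁰∘s − Π⁰‖²` -/

/-- translation invariance of `‖Π⁰‖²`. [folklore] -/
theorem sum_piR_sq_shift (f : Tor L → ℝ) (s : Cfg L) :
    ∑ c : Cfg L, piR L f (c + s) ^ 2 = ∑ c : Cfg L, piR L f c ^ 2 :=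
  Fintype.sum_equiv (Equiv.addRight s) _ _ (fun _ => rfl)

/-- `Σ_c Π(c)Π(c+s) = ‖Π‖² − ½ Σ_c (Π(c+s) − Π(c))²`. [folklore] -/
theorem sum_piR_mul_shift (f : Tor L → ℝ) (s : Cfg L) :
    ∑ c : Cfg L, piR L f c * piR L f (c + s)
      = PiNormSq L f - (1 / 2) * ∑ c : Cfg L, (piR L f (c + s) - piR L f c) ^ 2 := by
  have h := sum_piR_sq_shift L f s
  unfold PiNormSq
  have hpt : ∀ c : Cfg L, (piR L f (c + s) - piR L f c) ^ 2
      = piR L f (c + s) ^ 2 + piR L f c ^ 2 - 2 * (piR L f c * piR L f (c + s)) := by intro c; ring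
  rw [Finset.sum_congr rfl fun c _ => hpt c, Finset.sum_sub_distrib, Finset.sum_add_distrib, ← Finset.mul_sum, h]
  ring

/-- the three `x̂`-hops of `DiscreteIMS`: `Re Σ Π⁰(Π⁰∘hop₁ + Π⁰∘hop₂ + Π⁰∘hop₃) = 3‖Π⁰‖² − ½G₂`. [folklore] -/
theorem hopSum_re (f : Tor L → ℝ) :
    (∑ c : Cfg L, prodState L f c *
        (prodState L f (c.1 + K1 L, c.2) + prodState L f (c.1, c.2 + K1 L) + prodState L f (c.1 - K1 L, c.2 - K1 L))).re
      = 3 * PiNormSq L f - (1 / 2) * G2term L f := by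
  -- as a real sum
  have hre : (∑ c : Cfg L, prodState L f c *
        (prodState L f (c.1 + K1 L, c.2) + prodState L f (c.1, c.2 + K1 L) + prodState L f (c.1 - K1 L, c.2 - K1 L))).re
      = ∑ c : Cfg L, (piR L f c * piR L f (c + (K1 L, 0)) + piR L f c * piR L f (c + (0, K1 L))
          + piR L f c * piR L f (c + (-K1 L, -K1 L))) := by
    rw [Complex.re_sum]
    refine Finset.sum_congr rfl fun c _ => ?_
    simp only [prodState_eq_piR]
    have e1 : piR L f (c + (K1 L, 0)) = piR L f (c.1 + K1 L, c.2) := by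
      unfold piR; simp only [Prod.fst_add, Prod.snd_add, add_zero]
    have e2 : piR L f (c + (0, K1 L)) = piR L f (c.1, c.2 + K1 L) := by
      unfold piR; simp only [Prod.fst_add, Prod.snd_add, add_zero]
    have e3 : piR L f (c + (-K1 L, -K1 L)) = piR L f (c.1 - K1 L, c.2 - K1 L) := by
      unfold piR; simp only [Prod.fst_add, Prod.snd_add, ← sub_eq_add_neg]
    rw [e1, e2, e3]
    simp only [← Complex.ofReal_add, ← Complex.ofReal_mul, Complex.ofReal_re]
    ring
  rw [hre, Finset.sum_add_distrib, Finset.sum_add_distrib, sum_piR_mul_shift, sum_piR_mul_shift, sum_piR_mul_shift]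
  -- `G₂` in the same shifted form
  have hG : G2term L f = ∑ c : Cfg L, (piR L f (c + (K1 L, 0)) - piR L f c) ^ 2
      + ∑ c : Cfg L, (piR L f (c + (0, K1 L)) - piR L f c) ^ 2
      + ∑ c : Cfg L, (piR L f (c + (-K1 L, -K1 L)) - piR L f c) ^ 2 := by
    unfold G2term
    rw [← Finset.sum_add_distrib, ← Finset.sum_add_distrib]
    refine Finset.sum_congr rfl fun c _ => ?_
    have e1 : piR L f (c + (K1 L, 0)) = piR L f (c.1 + K1 L, c.2) := by
      unfold piR; simp only [Prod.fst_add, Prod.snd_add, add_zero]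
    have e2 : piR L f (c + (0, K1 L)) = piR L f (c.1, c.2 + K1 L) := by
      unfold piR; simp only [Prod.fst_add, Prod.snd_add, add_zero]
    have e3 : piR L f (c + (-K1 L, -K1 L)) = piR L f (c.1 - K1 L, c.2 - K1 L) := by
      unfold piR; simp only [Prod.fst_add, Prod.snd_add, ← sub_eq_add_neg]
    rw [e1, e2, e3]
  rw [hG]
  ring

/-! ## The identity -/

/-- ★ **`N1Identity L Δ` holds.** [folklore] -/
theorem n1Identity_holds (Δ : ℝ) : N1Identity L Δ := by
  intro lam2 f hf
  have hL : 2 ≤ L := by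
    by_contra h
    have hL1 : L = 1 := by have := NeZero.ne L; omega
    obtain ⟨h0, -, hpos, -, -⟩ := hf
    subst hL1
    rw [show K1 1 = 0 from Subsingleton.elim _ _, h0] at hpos
    exact lt_irrefl _ hpos
  -- the pieces
  have hIMS := discreteIMS_holds L hL f
  have hH : (ip L (trialK1 L f) (Happly L (K1 L) Δ (trialK1 L f))).re
      = (ip L (trialK1 L f) (H0apply L (K1 L) (trialK1 L f))).re
        - Δ * ∑ c : Cfg L, (Wcount L c : ℝ) * ‖trialK1 L f c‖ ^ 2 := re_ip_Happly L (K1 L) Δ (trialK1 L f)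
  have hV := re_ip_vsqPi_H0 L f
  have hhop := hopSum_re L f
  have hself := ip_trialK1_self_re L f
  have hW := sum_W_trialK1 L f
  have hC0 := sum_piR_C0fn L hf
  -- the |v|² form with C0
  have hVC : ∑ c : Cfg L, (3 + 2 * kapV L c) * piR L f c * (H0apply L 0 (prodState L f) c).re
      = 3 * ∑ c : Cfg L, piR L f c * C0fn L Δ lam2 f c + 2 * ∑ c : Cfg L, kapV L c * piR L f c * C0fn L Δ lam2 f c
        + 9 * lam2 * ∑ c : Cfg L, piR L f c ^ 2 + 6 * lam2 * ∑ c : Cfg L, kapV L c * piR L f c ^ 2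
        + Δ * ∑ c : Cfg L, (Wcount L c : ℝ) * ((3 + 2 * kapV L c) * piR L f c ^ 2) := by
    have hpt : ∀ c : Cfg L, (3 + 2 * kapV L c) * piR L f c * (H0apply L 0 (prodState L f) c).re
        = 3 * (piR L f c * C0fn L Δ lam2 f c) + 2 * (kapV L c * piR L f c * C0fn L Δ lam2 f c)
          + 9 * lam2 * (piR L f c ^ 2) + 6 * lam2 * (kapV L c * piR L f c ^ 2)
          + Δ * ((Wcount L c : ℝ) * ((3 + 2 * kapV L c) * piR L f c ^ 2)) := by
      intro c
      have h := piR_mul_H0apply_re L hf c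
      linear_combination (3 + 2 * kapV L c) * h
    rw [Finset.sum_congr rfl fun c _ => hpt c]
    simp only [Finset.sum_add_distrib, ← Finset.mul_sum]
  have hIMS' : (ip L (trialK1 L f) (H0apply L (K1 L) (trialK1 L f))).re
      = (ip L (fun c => ((Complex.normSq (vfun L c) : ℝ) : ℂ) * prodState L f c) (H0apply L 0 (prodState L f))).re
        + eps1 L * (∑ c : Cfg L, prodState L f c *
            (prodState L f (c.1 + K1 L, c.2) + prodState L f (c.1, c.2 + K1 L)
              + prodState L f (c.1 - K1 L, c.2 - K1 L))).re := hIMS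
  unfold trialGapN1
  rw [hH, hIMS', hV, hVC, hC0, hhop, hself, hW]
  unfold BCterm Bterm PiNormSq
  ring

end Summit.HubbardSuperconductivity.HubbardSuperconductivity.Theorems.AnisotropyChord.Transfer.Fibre3

end
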